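import Summits.BirchSwinnertonDyer.BirchSwinnertonDyer.Theorems.ByReductionTypeAtTwoRankOneAtTwoBigImageOddLocalOneDoorAnalyticAssembly
import Summits.BirchSwinnertonDyer.BirchSwinnertonDyer.Theorems.ByReductionTypeAtTwoRankOneAtTwoBigImageOddLocalOneDoorNonvanishingSupply
import Summits.BirchSwinnertonDyer.BirchSwinnertonDyer.Theorems.ByReductionTypeAtTwoRankOneAtTwoBigImageOddLocalOneDoorPrimaryDoor
import Literature.NumberTheory.EllipticCurves.GrossZagierRankOneProofs
import Literature.NumberTheory.EllipticCurves.LeadingTermHeegnerProofs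
import Literature.NumberTheory.EllipticCurves.HeegnerPointsModularityProofs
import Literature.NumberTheory.Automorphic.ShimuraCurveRibetTakahashiOptimalProofs
import HarnessLib

/-!
# Route ByReductionTypeAtTwo, crux `RankOneAtTwoBigImageOddLocal` (stmt-BirchSwinnertonDyer-23715), LINE v8.2 `one_door_analytic`:
# the crux BY NAME from FOUR primary printed facts + the ONE conjecture + the route's rank-`0` cruxes + Manin

Width prover seat `bsd-line-fkl-p2` g7 (2026-08-28), `--supports stmt-BirchSwinnertonDyer-23715`.  The lead's assembly
`rankOneAtTwoBigImageOddLocal_of_oneDoorAnalytic_primary` (`…OneDoorAnalyticAssembly.lean`, p618446) derives the crux from the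
PRINT conjunctions `S_pub ∧ S_pubHL` opened into SIX named facts of the tree: `gross_zagier`, `kolyvagin`,
`rank_eq_analyticRank_of_analyticRank_le_one` (GZK over `ℚ` — COMPOSITE: as a statement about every curve of analytic rank `≤ 1`
its rank-`0` half needs Murty–Murty / Bump–Friedberg–Hoffstein), `hasEntireLFunction_rat`, `exists_isNewformOf`,
`HoffsteinLuo1997_exists_twist_L_one_ne_zero`.  Two of the six are REDUNDANT on the slice, and this file removes them:

* `hasEntireLFunction_rat` is the tree theorem `hasEntireLFunction_rat_of_exists_isNewformOf` (modularity);
* GZK is used by the whole chain exactly once, as `W.mordellWeilRank = 1` for the curve `W` of analytic rank `1` at hand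
  (door `P2.bsdp_two_iff_of_heegner_rankOne`, re-proved with that local hypothesis in `…OneDoorPrimaryDoor.lean`), and on
  analytic rank `1` that equality follows from Gross–Zagier + Kolyvagin + Hoffstein–Luo + modularity ALONE
  (`mordellWeilRank_eq_one_of_analyticRank_eq_one`): `w(W) = −1` (parity, `even_analyticRank_iff_of_exists_isNewformOf`);
  a Heegner field `K` with `L(W^{(d_K)},1) ≠ 0` (Hoffstein–Luo, `exists_doorField_of_analyticRank_eq_one`, p617200); the
  `K`-rational Heegner point of a parametrisation datum (modularity: `nonempty_modularParametrizationData` ⟺ `exists_isNewformOf`,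
  `exists_isHeegnerPoint_of_nonempty_modularParametrizationData`); `L'(W/K,1) = L'(W,1)·L(W^{(d_K)},1) ≠ 0`, so the point has
  infinite order (Gross–Zagier) and `rank E(K) = 1`, `Ш(E/K)` finite (Kolyvagin); the reflection of `K` acts on the point by
  `−w(W) = +1` up to torsion (Darmon Prop. 3.11, the tree THEOREM `heegnerPoint_conj_add_rootNumber_smul_holds`), so
  `rank E(ℚ) ≥ 1` (`one_le_mordellWeilRank_of_conjMap_sub_isOfFinAddOrder`), and `rank E(ℚ) ≤ rank E(K) = 1`
  (`mordellWeilRank_add_eq_of_baseChange`) — the rank-`1` branch of Darmon's proof of Thm. 3.22 as typed in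
  `LeadingTermHeegnerProofs` (`rank_eq_analyticRank_of_isGloballyMinimal_of_heegnerPoint`, whose packaged form also carries the
  rank-`0` branch and hence Murty–Murty).

Contents: §1 `mordellWeilRank_eq_one_of_analyticRank_eq_one_of_isGloballyMinimal` / `…_of_analyticRank_eq_one` (rank-`1`
GZK over `ℚ` from the four primary facts, with `Ш(E/ℚ)` finite); §2 `doorGlueAn_of_primary` — the glue `doorGlueAn` (-an g11 /
lead g6, p617456) VERBATIM over the re-proved door, binders `hGZ`, `hKo`, `hmod` in place of `S_pub`; §3
`rankOneAtTwoBigImageOddLocal_of_oneDoorAnalytic_primary4` — the crux BY NAME from `gross_zagier`, `kolyvagin`,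
`exists_isNewformOf`, `HoffsteinLuo1997_exists_twist_L_one_ne_zero`, the conjecture `DoorIndexLawFullAtTwo` (AN-28), the
route's four rank-`0` cruxes at `2`, and `S_manin`.

BSD is not proved by any of this; the final theorem is conditional by design on four PRINT named facts, one conjecture, four
open route items and the Manin receptacle (open only at `4 ∣ N`).
-/

set_option autoImplicit false

noncomputable section

open scoped Classical

set_option linter.dupNamespace false

namespace Summit.BirchSwinnertonDyer.BirchSwinnertonDyer.Theorems.RankOneAtTwoOneDoor

open WeierstrassCurve NumberField Literature.NumberTheory.EllipticCurves Literature.NumberTheory.EllipticCurves.ModularForms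
  Literature.NumberTheory.EllipticCurves.KrizLi2019
  Summit.BirchSwinnertonDyer.Rank1Residual.F1Sign2
  Summit.BirchSwinnertonDyer.Rank1Residual.F1Sign2.TranspositionDoor
  Summit.BirchSwinnertonDyer.Rank1Residual
  Summit.BirchSwinnertonDyer.BirchSwinnertonDyer.Theses.ByReductionTypeAtTwo

/-! ### §1 Rank-one GZK over `ℚ` from Gross–Zagier, Kolyvagin, modularity and Hoffstein–Luo -/

/-- **`ord_{s=1} L(E,s) = 1 ⇒ rank E(ℚ) = 1 ∧ #Ш(E/ℚ) < ∞` for a globally minimal model, from four primary printed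
facts**: Gross–Zagier (`hGZ`), Kolyvagin (`hKo`), modularity as a newform (`hnf`) and Hoffstein–Luo 1997 (`hHL`).  The rank-`1`
branch of Darmon's proof of Thm. 3.22: Heegner field by Hoffstein–Luo, Heegner point by modularity, non-torsion by Gross–Zagier,
`rank E(K) = 1` and `Ш(E/K)` finite by Kolyvagin, descent to `ℚ` by Prop. 3.11 (a theorem of the tree).
[cite: Darmon2004, Thm. 3.22 and §3.9] [cite: GrossZagier1986, Thm. I.6.3 and V.§2] -/
theorem mordellWeilRank_eq_one_of_analyticRank_eq_one_of_isGloballyMinimal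
    (hGZ : ∀ (N : ℕ) [NeZero N] (W : WeierstrassCurve ℚ) (K : Type) [Field K] [NumberField K], gross_zagier N W K)
    (hKo : ∀ (N : ℕ) [NeZero N] (W : WeierstrassCurve ℚ) (K : Type) [Field K] [NumberField K], kolyvagin N W K)
    (hnf : exists_isNewformOf) (hHL : HoffsteinLuo1997_exists_twist_L_one_ne_zero)
    (W : WeierstrassCurve ℚ) [W.IsElliptic] [W.IsGloballyMinimal] (hr : W.analyticRank = 1) :
    W.mordellWeilRank = 1 ∧ Finite W.sha := by
  haveI hN : NeZero (W.conductorNorm ℤ) := ⟨(W.conductorNorm_pos_holds).ne'⟩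
  have hmod : hasEntireLFunction_rat := hasEntireLFunction_rat_of_exists_isNewformOf hnf
  have hmodP : nonempty_modularParametrizationData :=
    nonempty_modularParametrizationData_iff_exists_isNewformOf_unconditional.mpr hnf
  -- the sign
  have hw : W.rootNumber = -1 := by
    have hiff : Even W.analyticRank ↔ W.rootNumber = 1 :=
      even_analyticRank_iff_rootNumber_eq_one_of_exists_isNewformOf W hnf
    rcases rootNumber_eq_one_or_eq_neg_one W with h1 | h1
    · exfalso
      have hev : Even W.analyticRank := hiff.mpr h1
      rw [hr] at hev
      exact Nat.not_even_one hev
    · exact h1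
  -- the Heegner field of Hoffstein–Luo: `L(W^{(d_K)}, 1) ≠ 0`, Heegner hypothesis
  obtain ⟨K, _iF, _iN, hK, -, hLt, -, hHN⟩ := exists_doorField_of_analyticRank_eq_one hnf hHL W hr
  have h2 : Module.finrank ℚ K = 2 := hK.1
  -- the Heegner point (modularity) and `L'(W/K, 1) ≠ 0`
  obtain ⟨P, hPH⟩ := exists_isHeegnerPoint_of_nonempty_modularParametrizationData W K hmodP hK hHN
  haveI hEK : (W.baseChange K).IsElliptic := isElliptic_baseChange' W K
  have hL0 : W.entireLFunction 1 = 0 := entireLFunction_one_eq_zero_of_analyticRank_eq_one hr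
  obtain ⟨-, hderiv⟩ := leadingLCoeff_eq_deriv_of_analyticRank_eq_one hr
  have hprod := lDerivEK_eq_deriv_mul W K hmod hL0
  have hLK : LDerivEK W K ≠ 0 := by rw [hprod]; exact mul_ne_zero hderiv hLt
  -- Gross–Zagier: the point has infinite order; Kolyvagin: `rank E(K) = 1`, `Ш(E/K)` finite
  have hPinf : ¬ IsOfFinAddOrder P :=
    (lDerivEK_ne_zero_iff_not_isOfFinAddOrder W (W.conductorNorm ℤ) K (hGZ _ W K) hK hHN hPH).mp hLK
  obtain ⟨hrkK, hShaK⟩ := hKo _ W K hK hHN hPH hPinf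
  have hShaW : W.ShaFinite := Literature.NumberTheory.EllipticCurves.shaFinite_of_baseChange W K hShaK
  refine ⟨?_, hShaW⟩
  -- the reflection of `K` and Prop. 3.11: `σ P − P` is torsion since `w(W) = −1`
  obtain ⟨θ, c, hθ, hc⟩ :=
    Literature.NumberTheory.QuadraticFields.Quadratic.exists_sq_eq_algebraMap (F := ℚ) (K := K) h2
  have hσ : Literature.NumberTheory.QuadraticFields.Quadratic.conj h2 hθ hc ≠ AlgHom.id ℚ K := by
    intro hid
    have h1' : Literature.NumberTheory.QuadraticFields.Quadratic.conj h2 hθ hc θ = -θ :=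
      Literature.NumberTheory.QuadraticFields.Quadratic.conj_gen h2 hθ hc
    rw [hid, AlgHom.id_apply] at h1'
    have h2θ : (2 : K) * θ = 0 := by linear_combination h1'
    exact Literature.NumberTheory.QuadraticFields.Quadratic.ne_zero_of_not_mem_range hθ
      ((mul_eq_zero.mp h2θ).resolve_left two_ne_zero)
  have hT := heegnerPoint_conj_add_rootNumber_smul_holds W K hK hHN hPH _ hσ
  rw [hw, neg_one_zsmul, ← sub_eq_add_neg] at hT
  -- descent: `rank E(ℚ) ≥ 1`, and `rank E(ℚ) ≤ rank E(K) = 1`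
  have hge := QuadraticDescent.one_le_mordellWeilRank_of_conjMap_sub_isOfFinAddOrder h2 W W.module_finite_point_holds hσ
    hPinf hT
  have hsum := W.mordellWeilRank_add_eq_of_baseChange K h2 one_ne_zero hrkK
  omega

/-- **Rank-one GZK over `ℚ`, any model**: `ord_{s=1} L(E,s) = 1 ⇒ rank E(ℚ) = 1 ∧ #Ш(E/ℚ) < ∞` from Gross–Zagier, Kolyvagin,
modularity as a newform and Hoffstein–Luo 1997 — `…_of_isGloballyMinimal` on a global minimal model
(`hasGlobalMinimalModel_rat_holds`) and the invariance of the rank, the analytic rank and the finiteness of `Ш` under changes of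
variables.  (The tree's packaged `rank_eq_analyticRank_of_analyticRank_le_one` additionally covers analytic rank `0`, which is where
Murty–Murty enters; the crux `RankOneAtTwoBigImageOddLocal` lives at analytic rank `1`.)
[cite: Darmon2004, Thm. 3.22 and §3.9] -/
theorem mordellWeilRank_eq_one_of_analyticRank_eq_one
    (hGZ : ∀ (N : ℕ) [NeZero N] (W : WeierstrassCurve ℚ) (K : Type) [Field K] [NumberField K], gross_zagier N W K)
    (hKo : ∀ (N : ℕ) [NeZero N] (W : WeierstrassCurve ℚ) (K : Type) [Field K] [NumberField K], kolyvagin N W K)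
    (hnf : exists_isNewformOf) (hHL : HoffsteinLuo1997_exists_twist_L_one_ne_zero)
    (W : WeierstrassCurve ℚ) [W.IsElliptic] (hr : W.analyticRank = 1) :
    W.mordellWeilRank = 1 ∧ Finite W.sha := by
  obtain ⟨C, hC⟩ := hasGlobalMinimalModel_rat_holds W
  haveI := hC
  have hanC : (C • W).analyticRank = W.analyticRank := analyticRank_variableChange_holds W C
  have hr' : (C • W).analyticRank = 1 := by rw [hanC, hr]
  obtain ⟨hrk, hs⟩ := mordellWeilRank_eq_one_of_analyticRank_eq_one_of_isGloballyMinimal hGZ hKo hnf hHL (C • W) hr'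
  have hrkC : (C • W).mordellWeilRank = W.mordellWeilRank := mordellWeilRank_variableChange_holds W C
  exact ⟨by rwa [hrkC] at hrk, (shaFinite_variableChange_iff_holds W C).mp hs⟩

/-! ### §2 The glue over the re-proved door: binders `hGZ`, `hKo`, `hmod` in place of `S_pub` -/

/-- **The v8 glue with the GZK conjunct of `S_pub` DROPPED**: Gross–Zagier (`hGZ`), Kolyvagin (`hKo`) and the entire continuation
(`hmod`) `→ DoorIndexLawFullAtTwo → DoorTwinValueAtTwo → DoorSupplyAnalyticAtTwo → S_manin → S_sliceMW`.  Proof = `doorGlueAn`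
(planner -an g11 / lead g6, p617456) verbatim, with the Heegner rationality conjunct supplied by the tree theorem
`heegnerPointComplex_mem_range_map_holds` and the door `bsdp_two_iff_of_heegner_rankOne_of_rank` fed the slice hypothesis
`rank E(ℚ) = 1` of `S_sliceMW` instead of the global GZK fact.
[cite: GrossZagier1986, Thm. I.6.3 and V.§2] [cite: Pal2012, Prop. 2.5 and Cor. 2.6] -/
theorem doorGlueAn_of_primary
    (hGZ : ∀ (N : ℕ) [NeZero N] (W : WeierstrassCurve ℚ) (K : Type) [Field K] [NumberField K], gross_zagier N W K)
    (hKo : ∀ (N : ℕ) [NeZero N] (W : WeierstrassCurve ℚ) (K : Type) [Field K] [NumberField K], kolyvagin N W K)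
    (hmod : hasEntireLFunction_rat) :
    DoorIndexLawFullAtTwo → DoorTwinValueAtTwo → DoorSupplyAnalyticAtTwo → S_manin → S_sliceMW := by
  intro hIdx hVal hSup hMan W _ _ hCM hsurj hT hc hr hrk
  haveI : Fact (Nat.Prime 2) := ⟨Nat.prime_two⟩
  haveI hN : NeZero (W.conductorNorm ℤ) := ⟨(W.conductorNorm_pos_holds).ne'⟩
  set N : ℕ := W.conductorNorm ℤ with hN_def
  -- `E(ℚ)[2] = 0`
  have hT2 : NoRationalTwoTorsion W := noRationalTwoTorsion_of_odd_torsionOrder W hT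
  -- the door field (Waldspurger–Hoffstein–Luo): admissible, `L(E^{(d_K)},1) ≠ 0`, Heegner
  obtain ⟨K, _iF, _iN, hK, hadm, hLt, -, hHN⟩ := hSup W hr
  have h2 : Module.finrank ℚ K = 2 := hK.1
  haveI : IsTotallyComplex K := hK.2
  -- the odd-constant parametrisation, the Heegner datum, an embedding, the `K`-rational Heegner point
  obtain ⟨Dt, hcodd⟩ := hMan W hT2
  obtain ⟨H, -⟩ := nonempty_heegnerDatum_holds N K hK (exists_dvd_sq_sub_discr_holds N K hK hHN).choose_spec
  obtain ⟨ι⟩ : Nonempty (K →+* ℂ) := inferInstance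
  have hrat : heegnerPointComplex_mem_range_map N W K := heegnerPointComplex_mem_range_map_holds N W K
  obtain ⟨P, hP⟩ := hrat hK hHN Dt H ι
  -- the minimal twist model and the value law (rank-`0` `BSD₂` of the twin, `s_d` floating)
  have hD0 : (NumberField.discr K : ℚ) ≠ 0 := by exact_mod_cast NumberField.discr_ne_zero K
  haveI hEt : (W.quadraticTwist (NumberField.discr K : ℚ)).IsElliptic := W.isElliptic_quadraticTwist hD0
  obtain ⟨Cd, hCd⟩ := hasGlobalMinimalModel_rat_holds (W.quadraticTwist (NumberField.discr K : ℚ))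
  haveI : (Cd • W.quadraticTwist (NumberField.discr K : ℚ)).IsGloballyMinimal := hCd
  set Wd := Cd • W.quadraticTwist (NumberField.discr K : ℚ) with hWd_def
  have hWd : Cd • W.quadraticTwist (NumberField.discr K : ℚ) = Wd := rfl
  obtain ⟨hfinWd, qd, hqd, hqd0, hvqd⟩ := hVal W hCM hT2 (NumberField.discr K) hadm hLt Wd Cd hWd
  set sd : ℕ := padicValNat 2 (Nat.card (AddCommGroup.primaryComponent Wd.sha 2)) with hsd_def
  -- the door index law at `(K, Dt, H, ι, P, Wd)`
  obtain ⟨m, ⟨Q, hPQ, hQ⟩, hlaw⟩ :=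
    hIdx W hCM hsurj hT hc hr K hK hadm hLt Dt H ι P hP hcodd Wd Cd hWd
  -- the door
  have hc0 : Dt.c ≠ 0 := by
    intro h0; apply hcodd; rw [h0]; exact dvd_zero _
  obtain ⟨k, hk12, hkiff, hdoor⟩ :=
    bsdp_two_iff_of_heegner_rankOne_of_rank W N K Dt H ι P (hGZ N W K) (hKo N W K) hmod hK hHN hP hc0 hr hrk hLt Wd Cd
      hWd qd hqd
  apply hdoor.mpr
  ------------------------------------------------------------------ rank `E(K) = 1`, `Ш(E)` finite (as inside the door)
  haveI hEK : (W.baseChange K).IsElliptic := isElliptic_baseChange' W K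
  have hL0 : W.entireLFunction 1 = 0 := entireLFunction_one_eq_zero_of_analyticRank_eq_one hr
  obtain ⟨-, hderiv⟩ := leadingLCoeff_eq_deriv_of_analyticRank_eq_one hr
  have hprod := lDerivEK_eq_deriv_mul W K hmod hL0
  have hLK : LDerivEK W K ≠ 0 := by rw [hprod]; exact mul_ne_zero hderiv hLt
  have hPH : IsHeegnerPoint N W K P := ⟨Dt, H, ι, hP⟩
  have hPinf : ¬ IsOfFinAddOrder P :=
    (lDerivEK_ne_zero_iff_not_isOfFinAddOrder W N K (hGZ N W K) hK hHN hPH).mp hLK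
  obtain ⟨hrkK, hShaK⟩ := hKo N W K hK hHN hPH hPinf
  have hShaW : W.ShaFinite := Literature.NumberTheory.EllipticCurves.shaFinite_of_baseChange W K hShaK
  haveI hfinW : Finite W.sha := hShaW
  ------------------------------------------------------------------ `#E(K)_tors` odd, `k = 1`
  have htKodd : Odd (W.baseChange K).torsionOrder := odd_torsionOrder_baseChange_of_noRationalTwoTorsion W hT2 K h2
  have hk1 : k = 1 := by
    rcases hk12 with h | h
    · exact h
    · exact absurd (hkiff.mp h) (P2.not_forall_halvable_of_odd_torsionOrder W K h2 hrkK hrk htKodd)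
  ------------------------------------------------------------------ the index of `P`
  obtain ⟨gK, hgK, hgenK, -, -⟩ :=
    exists_generator_regulator_eq_of_mordellWeilRank_eq_one (W.baseChange K) hrkK
  have hQ' : ¬ ∃ Q' : (W.baseChange K).toAffine.Point,
      Q - 2 • Q' ∈ AddCommGroup.torsion (W.baseChange K).toAffine.Point := hQ
  obtain ⟨hI0, hvIdx⟩ := padicValNat_index_of_twoDivisibility (W.baseChange K) hgK hgenK hPQ hQ'
  have hvtK : padicValNat 2 (W.baseChange K).torsionOrder = 0 :=
    padicValNat.eq_zero_of_not_dvd (fun h => (Nat.not_even_iff_odd.mpr htKodd) (even_iff_two_dvd.mpr h))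
  ------------------------------------------------------------------ `w_K = 2`, `|u| = 1`
  have hw2 : Units.torsionOrder K = 2 :=
    Literature.NumberTheory.QuadraticFields.Quadratic.torsionOrder_eq_two_of_discr_lt_neg_four h2
      (discr_lt_neg_four_of_doorAdmissible hadm)
  have hu1 : |(Cd.u : ℚ)| = 1 := by
    rcases W.u_eq_one_or_eq_neg_one_of_smul_quadraticTwist_of_squarefree (emod_four_of_doorAdmissible hadm)
        hadm.2.1 (good_or_mult_at_dvd_of_doorAdmissible W hadm) Wd Cd hWd with h | h <;> rw [h] <;> simp
  ------------------------------------------------------------------ oddness of `c_W`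
  have hvcWn : padicValNat 2 W.tamagawaProduct = 0 :=
    padicValNat.eq_zero_of_not_dvd (fun h => (Nat.not_even_iff_odd.mpr hc) (even_iff_two_dvd.mpr h))
  ------------------------------------------------------------------ the valuation, factor by factor
  have hΔ0 : W.Δ ≠ 0 := W.isUnit_Δ.ne_zero
  have hI' : ((AddSubgroup.zmultiples P).index : ℚ) ≠ 0 := by exact_mod_cast hI0
  have htW' : (W.torsionOrder : ℚ) ≠ 0 := by exact_mod_cast (W.torsionOrder_pos_holds).ne'
  have htK' : ((W.baseChange K).torsionOrder : ℚ) ≠ 0 := by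
    exact_mod_cast ((W.baseChange K).torsionOrder_pos_holds).ne'
  have hcW' : (W.tamagawaProduct : ℚ) ≠ 0 := by exact_mod_cast (W.tamagawaProduct_pos_holds).ne'
  have hcM : (Dt.c : ℚ) ≠ 0 := by exact_mod_cast hc0
  have hw' : (Units.torsionOrder K : ℚ) ≠ 0 := by rw [hw2]; norm_num
  have hua : |(Cd.u : ℚ)| ≠ 0 := abs_ne_zero.mpr Cd.u.ne_zero
  have hk' : ((k : ℕ) : ℚ) ≠ 0 := by rw [hk1]; norm_num
  have hn12 : (W.baseChange ℝ).numRealComponents = 1 ∨ (W.baseChange ℝ).numRealComponents = 2 :=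
    numRealComponents_eq_one_or W
  have hn' : ((W.baseChange ℝ).numRealComponents : ℚ) ≠ 0 := by
    rcases hn12 with h | h <;> rw [h] <;> norm_num
  -- valuations of the single factors
  have h8 : padicValRat 2 (8 : ℚ) = 3 := by
    rw [show (8 : ℚ) = ((2 : ℕ) : ℚ) ^ 3 by norm_num, padicValRat.pow, padicValRat.self one_lt_two]; norm_num
  have hvI : padicValRat 2 ((AddSubgroup.zmultiples P).index : ℚ) = (m : ℤ) := by
    rw [padicValRat.of_nat, hvIdx, hvtK]; push_cast; ring
  have hvtW : padicValRat 2 (W.torsionOrder : ℚ) = 0 := by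
    rw [padicValRat.of_nat, padicValNat.eq_zero_of_not_dvd
      (fun h => (Nat.not_even_iff_odd.mpr hT) (even_iff_two_dvd.mpr h))]; rfl
  have hvtKq : padicValRat 2 ((W.baseChange K).torsionOrder : ℚ) = 0 := by
    rw [padicValRat.of_nat, hvtK]; rfl
  have hvcW : padicValRat 2 (W.tamagawaProduct : ℚ) = 0 := by
    rw [padicValRat.of_nat, hvcWn]; rfl
  have hvc : padicValRat 2 (Dt.c : ℚ) = 0 := by
    rw [padicValRat.of_int, padicValInt.eq_zero_of_not_dvd hcodd]; rfl
  have hvw : padicValRat 2 (Units.torsionOrder K : ℚ) = 1 := by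
    rw [hw2]; exact padicValRat.self one_lt_two
  have hvu : padicValRat 2 |(Cd.u : ℚ)| = 0 := by rw [hu1]; exact padicValRat.one
  have hvk : padicValRat 2 ((k : ℕ) : ℚ) = 0 := by
    rw [hk1, Nat.cast_one]; exact padicValRat.one
  have hvqd' : padicValRat 2 qd =
      (transpCount W (NumberField.discr K) : ℤ) + 2 * (identCount W (NumberField.discr K) : ℤ) + (sd : ℤ) := by
    rw [hvqd, hvcWn, hsd_def]; push_cast; ring
  -- numerator and denominator
  have hA1 : (8 : ℚ) * ((AddSubgroup.zmultiples P).index : ℚ) ^ 2 ≠ 0 :=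
    mul_ne_zero (by norm_num) (pow_ne_zero _ hI')
  have hA2 : (8 : ℚ) * ((AddSubgroup.zmultiples P).index : ℚ) ^ 2 * (W.torsionOrder : ℚ) ^ 2 ≠ 0 :=
    mul_ne_zero hA1 (pow_ne_zero _ htW')
  have hD1 : ((W.baseChange ℝ).numRealComponents : ℚ) * ((k : ℕ) : ℚ) ^ 2 ≠ 0 :=
    mul_ne_zero hn' (pow_ne_zero _ hk')
  have hD2 : ((W.baseChange ℝ).numRealComponents : ℚ) * ((k : ℕ) : ℚ) ^ 2 *
      ((W.baseChange K).torsionOrder : ℚ) ^ 2 ≠ 0 := mul_ne_zero hD1 (pow_ne_zero _ htK')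
  have hD3 : ((W.baseChange ℝ).numRealComponents : ℚ) * ((k : ℕ) : ℚ) ^ 2 *
      ((W.baseChange K).torsionOrder : ℚ) ^ 2 * (Dt.c : ℚ) ^ 2 ≠ 0 := mul_ne_zero hD2 (pow_ne_zero _ hcM)
  have hD4 : ((W.baseChange ℝ).numRealComponents : ℚ) * ((k : ℕ) : ℚ) ^ 2 *
      ((W.baseChange K).torsionOrder : ℚ) ^ 2 * (Dt.c : ℚ) ^ 2 * (Units.torsionOrder K : ℚ) ^ 2 ≠ 0 :=
    mul_ne_zero hD3 (pow_ne_zero _ hw')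
  have hD5 : ((W.baseChange ℝ).numRealComponents : ℚ) * ((k : ℕ) : ℚ) ^ 2 *
      ((W.baseChange K).torsionOrder : ℚ) ^ 2 * (Dt.c : ℚ) ^ 2 * (Units.torsionOrder K : ℚ) ^ 2 * qd ≠ 0 :=
    mul_ne_zero hD4 hqd0
  have hD6 : ((W.baseChange ℝ).numRealComponents : ℚ) * ((k : ℕ) : ℚ) ^ 2 *
      ((W.baseChange K).torsionOrder : ℚ) ^ 2 * (Dt.c : ℚ) ^ 2 * (Units.torsionOrder K : ℚ) ^ 2 * qd *
      |(Cd.u : ℚ)| ≠ 0 := mul_ne_zero hD5 hua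
  have hD7 : ((W.baseChange ℝ).numRealComponents : ℚ) * ((k : ℕ) : ℚ) ^ 2 *
      ((W.baseChange K).torsionOrder : ℚ) ^ 2 * (Dt.c : ℚ) ^ 2 * (Units.torsionOrder K : ℚ) ^ 2 * qd *
      |(Cd.u : ℚ)| * (W.tamagawaProduct : ℚ) ≠ 0 := mul_ne_zero hD6 hcW'
  have hnum : padicValRat 2 ((8 : ℚ) * ((AddSubgroup.zmultiples P).index : ℚ) ^ 2 * (W.torsionOrder : ℚ) ^ 2) =
      3 + 2 * (m : ℤ) := by
    rw [padicValRat.mul hA1 (pow_ne_zero _ htW'), padicValRat.mul (by norm_num) (pow_ne_zero _ hI'),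
      padicValRat.pow, padicValRat.pow, h8, hvI, hvtW]
    ring
  have hden : padicValRat 2 (((W.baseChange ℝ).numRealComponents : ℚ) * ((k : ℕ) : ℚ) ^ 2 *
      ((W.baseChange K).torsionOrder : ℚ) ^ 2 * (Dt.c : ℚ) ^ 2 * (Units.torsionOrder K : ℚ) ^ 2 * qd *
      |(Cd.u : ℚ)| * (W.tamagawaProduct : ℚ)) =
      padicValRat 2 ((W.baseChange ℝ).numRealComponents : ℚ) + 2 +
        ((transpCount W (NumberField.discr K) : ℤ) + 2 * (identCount W (NumberField.discr K) : ℤ) + (sd : ℤ)) := by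
    rw [padicValRat.mul hD6 hcW', padicValRat.mul hD5 hua, padicValRat.mul hD4 hqd0,
      padicValRat.mul hD3 (pow_ne_zero _ hw'), padicValRat.mul hD2 (pow_ne_zero _ hcM),
      padicValRat.mul hD1 (pow_ne_zero _ htK'), padicValRat.mul hn' (pow_ne_zero _ hk'),
      padicValRat.pow, padicValRat.pow, padicValRat.pow, padicValRat.pow,
      hvk, hvtKq, hvc, hvw, hvqd', hvu, hvcW]
    ring
  have hprim : padicValNat 2 (Nat.card (AddCommGroup.primaryComponent W.sha 2)) =
      padicValNat 2 (Nat.card W.sha) := padicValNat_card_addPrimaryComponent 2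
  rw [padicValRat.div hA2 hD7, hnum, hden, ← hprim]
  -- the law, by the sign of `Δ`
  rcases lt_or_gt_of_ne hΔ0 with hneg | hpos
  · rw [if_pos hneg] at hlaw
    rw [P2.numRealComponents_eq_one_of_Δ_neg hneg, Nat.cast_one, padicValRat.one]
    have hlawZ : (2 * m + 1 : ℤ) =
        (padicValNat 2 (Nat.card (AddCommGroup.primaryComponent W.sha 2)) : ℤ) + (sd : ℤ) +
          transpCount W (NumberField.discr K) + 2 * identCount W (NumberField.discr K) := by
      rw [hsd_def]; exact_mod_cast hlaw
    omega
  · rw [if_neg (not_lt.mpr hpos.le), add_zero] at hlaw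
    rw [P2.numRealComponents_eq_two_of_Δ_pos hpos, show ((2 : ℕ) : ℚ) = ((2 : ℕ) : ℚ) from rfl,
      padicValRat.self one_lt_two]
    have hlawZ : (2 * m : ℤ) =
        (padicValNat 2 (Nat.card (AddCommGroup.primaryComponent W.sha 2)) : ℤ) + (sd : ℤ) +
          transpCount W (NumberField.discr K) + 2 * identCount W (NumberField.discr K) := by
      rw [hsd_def]; exact_mod_cast hlaw
    omega

/-! ### §3 The crux BY NAME from four primary printed facts, the ONE conjecture, the route's rank-`0` cruxes and Manin -/

/-- **The crux `RankOneAtTwoBigImageOddLocal` BY NAME from LINE v8.2's inputs with the PRINT part reduced to FOUR PRIMARY named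
facts**: Gross–Zagier (`gross_zagier`), Kolyvagin (`kolyvagin`), modularity as a newform (`exists_isNewformOf`) and Hoffstein–Luo
1997 (`HoffsteinLuo1997_exists_twist_L_one_ne_zero`); plus the lens' conjecture `DoorIndexLawFullAtTwo` (AN-28, load-bearing), the
route's four rank-`0` cruxes at `2` BY NAME, and `S_manin`.  Compared with `rankOneAtTwoBigImageOddLocal_of_oneDoorAnalytic_primary`
(p618446) the binders `hGZK : rank_eq_analyticRank_of_analyticRank_le_one` and `hmod : hasEntireLFunction_rat` are gone (derived:
§1 and `hasEntireLFunction_rat_of_exists_isNewformOf`).  BSD is not proved by this: conditional by design. -/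
theorem rankOneAtTwoBigImageOddLocal_of_oneDoorAnalytic_primary4
    (hGZ : ∀ (N : ℕ) [NeZero N] (W : WeierstrassCurve ℚ) (K : Type) [Field K] [NumberField K], gross_zagier N W K)
    (hKo : ∀ (N : ℕ) [NeZero N] (W : WeierstrassCurve ℚ) (K : Type) [Field K] [NumberField K], kolyvagin N W K)
    (hnf : exists_isNewformOf) (hHL : HoffsteinLuo1997_exists_twist_L_one_ne_zero)
    (hIdx : DoorIndexLawFullAtTwo)
    (hR0 : GoodOrdinaryRankZeroAtTwo ∧ MultiplicativeRankZeroAtTwo ∧ SupersingularRankZeroAtTwo ∧ AdditiveRankZeroAtTwo)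
    (hMan : S_manin) : RankOneAtTwoBigImageOddLocal := by
  have hmod : hasEntireLFunction_rat := hasEntireLFunction_rat_of_exists_isNewformOf hnf
  intro W _ _ hCM hsurj hT hc hr
  have hrk : W.mordellWeilRank = 1 :=
    (mordellWeilRank_eq_one_of_analyticRank_eq_one_of_isGloballyMinimal hGZ hKo hnf hHL W hr).1
  exact doorGlueAn_of_primary hGZ hKo hmod hIdx
    (doorTwinValueAtTwo_of_rankZeroTwin hmod (rankZeroTwin_of_rankZero_cruxes hR0))
    (doorSupplyAnalyticAtTwo_of_hoffsteinLuo hnf hHL) hMan W hCM hsurj hT hc hr hrk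

/-- The same with the three open inputs left bundled as in the registered skeleton (`stub_doorIndexFull`'s guard `S_pub` is NOT
needed here: the conjecture is taken unguarded, exactly as in `…_primary`). The four rank-`0` cruxes enter through
`S_rankZeroTwin` (`rankZeroTwin_of_rankZero_cruxes`). -/
theorem rankOneAtTwoBigImageOddLocal_of_oneDoorAnalytic_primary4'
    (hGZ : ∀ (N : ℕ) [NeZero N] (W : WeierstrassCurve ℚ) (K : Type) [Field K] [NumberField K], gross_zagier N W K)
    (hKo : ∀ (N : ℕ) [NeZero N] (W : WeierstrassCurve ℚ) (K : Type) [Field K] [NumberField K], kolyvagin N W K)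
    (hnf : exists_isNewformOf) (hHL : HoffsteinLuo1997_exists_twist_L_one_ne_zero)
    (hIdx : DoorIndexLawFullAtTwo) (hZ : S_rankZeroTwin) (hMan : S_manin) : RankOneAtTwoBigImageOddLocal := by
  have hmod : hasEntireLFunction_rat := hasEntireLFunction_rat_of_exists_isNewformOf hnf
  intro W _ _ hCM hsurj hT hc hr
  have hrk : W.mordellWeilRank = 1 :=
    (mordellWeilRank_eq_one_of_analyticRank_eq_one_of_isGloballyMinimal hGZ hKo hnf hHL W hr).1
  exact doorGlueAn_of_primary hGZ hKo hmod hIdx (doorTwinValueAtTwo_of_rankZeroTwin hmod hZ)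
    (doorSupplyAnalyticAtTwo_of_hoffsteinLuo hnf hHL) hMan W hCM hsurj hT hc hr hrk

end Summit.BirchSwinnertonDyer.BirchSwinnertonDyer.Theorems.RankOneAtTwoOneDoor

end
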